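import Mathlib
import HarnessLib
import HarnessLib.Audit
import Summits.MatrixMultiplication.Statement
import Literature.Computability.AlgebraicComplexity.FlatteningBound
import Literature.Computability.AlgebraicComplexity.KroneckerRank
import HarnessLib.Audit.Status.Attr

/-!
Route: CubicExchangeSplit

DORMANT since 2026-08-25T05:36:44Z (reconciler: no traction for 7.4 d (last activity item-evidence-added at 2026-08-17T19:02:28Z); parked, not closed — `ledger route dormant route-MatrixMultiplication-CubicExchangeSplit --off` to reacti) — unstaffed, not closed; items shared with open routes are served there. `ledger route dormant <id> --off` reactivates.

# Route CubicExchangeSplit — omega = 2 iff cubic amortisation is perfect and the cubic exchange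
holds — the one cell where both halves are sub-record

Lens 3.4 (decomposition-first) applied to the summit-strength leaves X =
ShapeSubmodularity.ShapeSubmodular and
EPRFaces/LongBlockAmortisation.FaceMaximiser, both ≡ ω(ℂ) = 2 now that their partner E =
PerfectAmortisation is KNOWN
(Coppersmith1982 p.471; LottiRomani1983 Prop 4.1: inf_k [ω(1,1,k) − k] = 1). It suffices to show X₃
:= E₃ ∧ SUBMOD₃:
(E₃, crux CubicAmortisation) ω(1,1,3) = 4 — an n × n matrix times an n × n³ matrix in n^{4+o(1)}
operations, R⟨n,n,n³⟩ =
O(n^{4+ε}); (SUBMOD₃, crux CubicExchange) the lattice exchange law at the single pair p = (3,1,1), q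
= (1,3,1):
ω(3,3,1) + ω(1,1,1) ≤ ω(3,1,1) + ω(1,3,1), in rank form. ω = 2 ⟺ E₃ ∧ SUBMOD₃ (→: blocking and
max-of-pairwise-sums;
←: the deciding theorem), and NEITHER conjunct, if proved, would lower the bound on ω: E₃ ⇒ ω ≤ 12/5
only (single-summand
asymptotic sum inequality), SUBMOD₃ ⇒ ω ≤ 2(ω(1,1,3) − 3) ≤ 2.397618 only (printed ω(1,1,3) ≤
4.198809) — both above
the record 2.371339. No card is realised (lens route); the parents' cards are
shape-submodularity-border-mrr2 and
epr-faces-amortised-module-border-rank.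
Lean: `(∀ ε : ℝ, 0 < ε → (fun n : ℕ => (Literature.Computability.AlgebraicComplexity.tensorRank
(Literature.Computability.AlgebraicComplexity.matMulTensor ℂ n n (n ^ 3)) : ℝ)) =O[Filter.atTop] fun
n : ℕ => (n : ℝ) ^ ((4 : ℝ) + ε)) ∧ (∀ β β' : ℝ, (fun n : ℕ =>
(Literature.Computability.AlgebraicComplexity.tensorRank
(Literature.Computability.AlgebraicComplexity.matMulTensor ℂ (n ^ 3) n n) : ℝ)) =O[Filter.atTop]
(fun n : ℕ => (n : ℝ) ^ β) → (fun n : ℕ => (Literature.Computability.AlgebraicComplexity.tensorRank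
(Literature.Computability.AlgebraicComplexity.matMulTensor ℂ n (n ^ 3) n) : ℝ)) =O[Filter.atTop]
(fun n : ℕ => (n : ℝ) ^ β') → ∀ ε : ℝ, 0 < ε → ∃ γ γ' : ℝ, γ + γ' ≤ β + β' + ε ∧ (fun n : ℕ =>
(Literature.Computability.AlgebraicComplexity.tensorRank
(Literature.Computability.AlgebraicComplexity.matMulTensor ℂ (n ^ 3) (n ^ 3) n) : ℝ))
=O[Filter.atTop] (fun n : ℕ => (n : ℝ) ^ γ) ∧ (fun n : ℕ =>
(Literature.Computability.AlgebraicComplexity.tensorRank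
(Literature.Computability.AlgebraicComplexity.matMulTensor ℂ n n n) : ℝ)) =O[Filter.atTop] (fun n :
ℕ => (n : ℝ) ^ γ'))`

## Assembly
The deciding theorem `closes (hA : CubicAmortisation) (hX : CubicExchange) : MatrixMultiplication`
is PROVED in glue.lean
(75 lines, tree lemmas only; certified by the native check): E₃ at slack ε/8 is the admissible
exponent 4 + ε/8 for
⟨n,n,n³⟩; the rotations `tensorRank_matMulTensor_rotate` move it to the formats ⟨n³,n,n⟩ and
⟨n,n³,n⟩; SUBMOD₃ at slack
ε/4 returns admissible γ for the join ⟨n³,n³,n⟩ and γ' for the meet ⟨n,n,n⟩ with γ + γ' ≤ 8 + ε/2;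
flattening
(`mul_le_tensorRank_matMulTensor_left`: n³·n³ ≤ R⟨n³,n³,n⟩, so any O(n^γ) bound forces 6 ≤ γ, a
25-line real-analysis
lemma) gives γ ≥ 6; γ' ∈ admissibleExponents ℂ gives ω ≤ γ' (`csInf_le`,
`admissibleExponents_bddBelow`); hence
ω ≤ 2 + ε/2 for every ε, ω ≤ 2, and `omega_two_le` + `MatrixMultiplication_iff` finish. It is the
ShapeSubmodularity
bridge frozen at k = 3 with the known E replaced by the open E₃ — not a one-line seam: the content
is the flattening on
the join and the format rotations.

Rationale: WHY THIS LINE. Write φ(x) = ω(1,1,x) (convex, tree `omegaRect_convexOn_middle_holds`; φ ≥ max(2,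
x+1); φ = 2 on [0,α]; φ(1) = ω) and
e(k) = φ(k) − k − 1 ≥ 0, nonincreasing, e(∞) = 0 by Coppersmith1982/LottiRomani1983. Two facts typed
this session decide
where ω = 2 can be cut along the amortisation axis: (i) the FACE LAW "ω − 2 ≤ e(k)" (EPRFaces' B at
level k) is
summit-equivalent at EVERY k ≥ 2 (slopes of φ are nondecreasing, average exactly 1 on [1,k] under
B(k), at most 1 on
every [1,m] by blocking, hence ≡ 1 beyond k − 1, and e(∞) = 0 forces ω = 2) — so B admits no
sub-summit instance; (ii)
the EXCHANGE LAW "ω − 2 ≤ 2e(k)" (ShapeSubmodular at the pair (k,1,1)&(1,k,1), by flattening on the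
join) is NOT
summit-equivalent (convexity only yields ω ≤ (3/5)φ(3) ≤ 2.52 from it) and is sub-record exactly for
k ∈ {2,3}
(2e(2) = 0.500, 2e(3) = 0.3976 ≥ 0.3713 > 2e(4) ≈ 0.35); on the amortisation side e(2) = 0 is
record-strength
(ω ≤ 9/4) while e(3) = 0 is not (ω ≤ 12/5). Hence k = 3 is the unique cell of the parents' own
bridge at which ω = 2
splits into two conjuncts each consistent with ω = 2.3713 — the typed split this route files, with
the bridge PROVED
(75 lines, rotation + flattening + csInf, tree only). Imported: convex analysis of Strassen's
spectrum of matrix shapes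
(Strassen1988, LottiRomani1983, doi:10.1006/jcom.1998.0476 §8), the CLLZ barrier calculus
(ChristandlLeGallLysikovZuiddam2025
Thm 3.15 / eq. (5)), for which the p = 3 cap over all CW_q was COMPUTED here (new numerics,
compute/cllz_cap.py,
reproducing the tree's vendored p = 2 row 3.062625 at θ₁ = 0.096 exactly). What prior routes do not:
EPRFaces and
ShapeSubmodularity pair a summit-equivalent axiom with a known theorem; this line pairs two strictly
sub-record statements
and records why no other cell of that axis does.

RANKED CRUXES. #2 CubicAmortisation (crux) — E₃, perfect cubic amortisation: for every ε > 0,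
R(⟨n,n,n³⟩) = O(n^{4+ε}) (R = tensorRank ∘ matMulTensor ℂ), i.e. ω(1,1,3) = 4 = its flattening
bound: applying an n × n matrix to n³ vectors costs n^{1+o(1)} per vector. The k = 3 rung below
EPRFaces.RectExponentTwoEqThree (k = 2, which implies it by blocking) and above the known k = ∞
(Coppersmith 1982). [difficulty: open-problem] (why it might fail: record ω(1,1,3) ≤ 4.198809
(VXXZ2024); every CW_q T-method is capped at ω̂(1,1,3) ≥ 4.0344 (q=2) … 4.1136 (q=14) by CLLZ Thm
3.15 (computed here), so a carrier outside {CW_q} with first-order-free leg-1 entropy is needed.)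
[VassilevskaWilliamsXuXuZhou2024, ChristandlLeGallLysikovZuiddam2025, Coppersmith1982,
LottiRomani1983, LeGallUrrutia2018]
#3 CubicExchange (crux) — SUBMOD₃, the cubic exchange: for all real β, β' with R(⟨n³,n,n⟩) = O(n^β)
and R(⟨n,n³,n⟩) = O(n^{β'}) and every ε > 0 there are γ, γ' with γ + γ' ≤ β + β' + ε, R(⟨n³,n³,n⟩) =
O(n^γ) and R(⟨n,n,n⟩) = O(n^{γ'}) — ShapeSubmodularity.ShapeSubmodular at the one lattice pair
(3,1,1)&(1,3,1) (join (3,3,1), meet (1,1,1)), up to n¹ = n; equivalently ω(3,3,1) + ω ≤ 2ω(1,1,3),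
i.e. ω − 2 ≤ 2e(3) + (6 − ω(3,3,1)). [difficulty: open-problem] (why it might fail: an ω-maximising
spectral point deep in the interior (ω − 2 > 2e(3), e.g. ω > 2.3976 with ω(1,1,3) = 4.1988) violates
it; no exchange theorem among exponents is in print and no lower-bound technology can refute it
short of ω > 2.) [Strassen1988, LottiRomani1983, ChristandlLeGallLysikovZuiddam2025, AlmanLi2026,
VassilevskaWilliamsXuXuZhou2024]
#9 AmortisationOfOmegaTwo (support) — necessity of E₃: ω(ℂ) = 2 → CubicAmortisation (block ⟨n,n,n³⟩
= ⟨1,1,n²⟩ ⊠ ⟨n,n,n⟩: R ≤ n²·R⟨n,n,n⟩ = O(n^{4+ε}) by Blaser2013_rank_matMulTensor_mul_le and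
tensorRank_matMulTensor_le); records that refuting E₃ refutes the summit. [difficulty: provable-now]
[Blaser2013, LottiRomani1983]
#9 ExchangeOfOmegaTwo (support) — necessity of SUBMOD₃: ω(ℂ) = 2 → CubicExchange (ω = 2 gives
R⟨n³,n³,n⟩ = O(n^{6+ε}) via ⟨n²,n²,1⟩ ⊠ ⟨n,n,n⟩ and R⟨n,n,n⟩ = O(n^{2+ε}); flattening forces β, β' ≥
4, so γ = 6 + ε/2, γ' = 2 + ε/2 serve); records that refuting SUBMOD₃ refutes the summit.
[difficulty: M] [LottiRomani1983, Blaser2013]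
#9 AmortisationConsequence (support) — what E₃ alone gives: CubicAmortisation → ω ≤ 12/5, by the
single-summand asymptotic sum inequality (n·n·n³)^{ω/3} ≤ R̃⟨n,n,n³⟩ ≤ R⟨n,n,n³⟩ (tree
sum_rpow_omega_le_asymptoticRank, as in EPRFaces.RungTwoConsequences); certifies that E₃ is not
record-strength (12/5 > 2.371339). [difficulty: M] [AlmanDuanVassilevskaWilliamsXuXuZhou2025,
Blaser2013, LottiRomani1983]
#9 ExchangeConsequence (support) — what SUBMOD₃ alone gives (the two-beta bridge at k = 3, = the
deciding theorem minus E₃): CubicExchange → every admissible β for ⟨n,n,n³⟩ bounds ω ≤ 2(β − 3);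
with the printed ω(1,1,3) ≤ 4.198809 this is ω ≤ 2.397618, not a record. [difficulty: provable-now]
[LottiRomani1983, VassilevskaWilliamsXuXuZhou2024]
#9 FaceMaximiserOfSubs (support) — X_of_subs for the ceiling leaf X = FaceMaximiser
(EPRFaces/LongBlockAmortisation, ≡ S): CubicAmortisation → CubicExchange → B, with B's signature
inlined verbatim (for every k ≥ 1 and admissible β for ⟨n,n,n^k⟩, ω + (k − 1) ≤ β); proof = deciding
theorem then EPRFaces.Converse (proved, Theorems converse_proof). [difficulty: provable-now]
[Strassen1988, Coppersmith1982, LottiRomani1983]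
#9 ShapeSubmodularOfSubs (support) — X_of_subs for the ceiling leaf X = ShapeSubmodular (tier-B
parent, ≡ S): CubicAmortisation → CubicExchange → SUBMOD on the whole integer format lattice,
ShapeSubmodular's signature inlined verbatim; proof = deciding theorem then
ShapeSubmodularity.SubmodOfOmegaTwo (open support of the parent, difficulty M). [difficulty: M]
[LottiRomani1983, Blaser2013, Strassen1988]

TWO-LAYER PLAN. CubicAmortisation ⇐ Carrier → Soundness → CubicAmortisation (birth skeleton
bc/CubicAmortisation_birth.lean, rc 0, 2 stubs):
Carrier = ∃ T ∉ {CW_q} with an asymptotic T-method bound ω̂(1,1,3) ≤ 4 + η for every η (tree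
`IsTMethodBound ℂ T 3 (4+η)`),
Soundness = CLLZ Thm 2.1 at p = 3 in rank form (named fact `CLLZ2025_tMethodBound_sound` + the
omegaRect/rank-form
dictionary); alternative layer-2 child: abelian STPP long blocks ⟨n,n,n³⟩ at packing slack η → 0
(the tree's proved CKSU
5.3 + rectangular ASI certificate of the retired LongBlockAmortisation, re-aimed from k = ∞ to k =
3).
CubicExchange ⇐ CoMax → CoMaxExchange → CubicExchange (bc/CubicExchange_birth.lean, rc 0, 2 stubs):
CoMax = one universal
spectral point maximises both ⟨2,2,2⟩ and ⟨8,8,2⟩ (Strassen duality, tree); or the finite shadow: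
border-rank
log-submodularity on the cubic rays, bR⟨8^N,8^N,2^N⟩·bR⟨2^N,2^N,2^N⟩ ≤ bR⟨8^N,2^N,2^N⟩², first cell
7·bR⟨8,8,2⟩ ≤ bR⟨2,2,8⟩²
(needs bR⟨8,8,2⟩ ≤ 96 if bR⟨2,2,8⟩ = 26; window today roughly [72, 102]).

KILL CRITERIA. ¬CubicExchange (a three-leg exchange violation at the cubic pair, i.e. ω − 2 > 2e(3)
proved) refutes crux 3 AND the summit
(ExchangeOfOmegaTwo): close `refuted:CubicExchange` and hand the witness to BorderRankLowerBound as
a dark-point certificate.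
¬CubicAmortisation (a module bound R⟨n,n,n³⟩ ≥ n^{4+c}) refutes crux 2 AND the summit
(AmortisationOfOmegaTwo): close
`refuted:CubicAmortisation` (it also refutes EPRFaces.RectExponentTwoEqThree). A proof of ω > 12/5
elsewhere refutes E₃;
ω > 2.397618 refutes SUBMOD₃ with the printed ω(1,1,3) bound. ω = 2 proved elsewhere moots the route
(both conjuncts
follow); ShapeSubmodular or FaceMaximiser proved elsewhere also moots it (each ≡ S).

NOT DECOMPOSED YET. The carrier for E₃ (which tensor family meets the CLLZ tangency spec at p = 3 —
first-order-free leg-1 entropy on a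
support with uniform leg-2/3 marginals) and its value analysis; the k = 2 sibling cell
{RectExponentTwoEqThree, SUBMOD₂}
(E₂ is record-strength, SUBMOD₂ ⇒ ω ≤ 2.5001; shares the bridge, deliberately not filed to keep the
route thin); the
spectral (laminarity) form of SUBMOD₃ beyond CoMax; the finite border-rank shadow cells beyond m =
2; continuity in the
exponent (irrelevant: only natural formats enter).

CHEAPEST FALSIFIER. RUN this session: (1) the CLLZ cap at p = 3 for every CW_q, q = 2..14
(compute/cllz_cap.py, stdlib python, 2.5 min; the
p = 2 row reproduces the vendored 3.062625 at θ₁ = 0.096 to six digits): ω̂(1,1,3) ≥ 4.034402 (q=2,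
θ₁ = 0.0495),
4.041174, 4.048310, 4.055500, 4.062623, 4.069622, 4.076463 (q=8), 4.089608 (10), 4.101987 (12),
4.113592 (14) — so E₃
is out of reach of every CW_q method but NOT refuted; informative, not a kill. (2) Convexity audit
that neither conjunct is
summit-equivalent (NOTES §Analysis (a),(c): SUBMOD₃ ⇒ only ω ≤ min(2φ(3) − 6, (3/5)φ(3)) ≤ 2.3976;
E₃ ⇒ ω ≤ min(12/5,
(8 − 4α)/(3 − α)) = 2.4). The one live cheap cell for a refuter is the finite shadow 7·bR⟨8,8,2⟩ ≤
bR⟨2,2,8⟩²: a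
Strassen-commutator / Koszul computation on the 64-leg of ⟨8,2,8⟩ pushing bR⟨8,8,2⟩ above 96 kills
the finite engine of
crux 3 (not the crux).

NUMBERS. ω ≤ 2.371339 (AlmanDuanVassilevskaWilliamsXuXuZhou2025); ω(1,2,1) ≤ 3.250035 (idem, Table
1) so 2e(2) ≤ 0.50007;
ω(1,3,1) ≤ 4.198809 (VassilevskaWilliamsXuXuZhou2024 Table 1, vendored `vxxz2024_omegaRect_table`
row (3, 4.198809)) so
2e(3) ≤ 0.397618 and SUBMOD₃ ⇒ ω ≤ 2.397618; E₃ ⇒ ω ≤ 12/5 = 2.4 (ASI) and ≤ 2.5067 (convexity with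
α ≥ 0.321334);
e(∞) = 0 (Coppersmith1982; first-power cw_q laser: e(k) ≤ ln 2/ln(2k+4)); CLLZ caps for E₃ via CW_q:
4.0344 (q=2) …
4.1136 (q=14), all at θ₂ = θ₃ = (1−θ₁)/2, θ₁ ∈ [0.05, 0.13]; the vendored p = 2 caps 3.0626 …
3.1714. Flattening:
R⟨n³,n³,n⟩ ≥ n⁶, R⟨n,n,n³⟩ ≥ n⁴. Items at open: 9 (2 cruxes, 6 supports, assembly).

DEFINITION REQUESTS. None: tensorRank, matMulTensor, admissibleExponents, omega
(MatrixMultiplicationExponent), the flattening and rotation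
lemmas (FlatteningBound, KroneckerRank) are all the route file uses; IsTMethodBound
(RectangularBarrier), SpectralMap /
IsUniversalSpectralPoint / asymptoticRank (AsymptoticSpectrum) appear only in the birth skeletons.
Cite-fact wanted
(grounder): Le Gall–Urrutia 2018 Table 3 row k = 3 (arXiv:1708.05622) and the SODA 2025 table beyond
k = 2, to sharpen
2e(3).

Novelty: Searches (2026-08-17): `lit search --source zbmath "rectangular matrix multiplication exponent"
--year-from 2018` (10 rows:
arXiv:2307.07970, 2307.06535, 2404.16349, 2003.03019, 2409.19292, 1606.04085 … — laser-method tables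
and the CLLZ barrier,
no decomposition of ω = 2 into rectangular conjuncts); `lit search --source zbmath "omega(1,1,k)
rectangular exponent convex
Lotti Romani"` (0 rows); `lit search --source crossref "submodular exponent matrix multiplication
shapes"` (6 rows:
Strassen FOCS 1986 spectrum, Pan 1984 — no exchange law); `lit search --hybrid "exponent of
multiplying an n by n matrix
with an n by n cubed matrix"` (8 book rows: BCS1997 pp. 410–412/484, Landsberg2017 p. 14 —
definitions of ω(1,1,k),
convexity, no split); `lit galaxy search "exponent of rectangular matrix multiplication" --star all`
(3 pdf rows,
applications only); `lit frontier MatrixMultiplication --since 2025` (30 rows; shape-relevant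
arXiv:2605.21738 §8
(convexity as extra axiom), arXiv:2601.21553 (support = quantum functionals, used for the cap
computation),
doi:10.1090/bull/1880); `lean search` for ⟨n,n,n³⟩ statements (1 hit: EPRFaces.Dichotomy with
4.198809); local searchd
DOWN (ConnectionReset ×3), arXiv/S2/OpenAlex HTTP 429 — logged. Hub: ShapeSubmodularity.lean,
EPRFaces.lean,
LongBlockAmortisation.lean (closed), RectangularAlpha read in full; evidence
MM_PerfectAmortisation_is_known.md (refuter
rreview-0816T16-0) and E_PerfectAmortisation_via_cwq.md (planner recomb-0) on stmt-10893 r  [refs: 10.1090/bull/1880, 10.1006/jcom.1998.0476, 2307.07970, 2605.21738, 2601.21553, doi:10.1090/bull/1880, doi:10.1006/jcom.1998.0476, Landsberg2017, LottiRomani1983, Coppersmith1982, ChristandlLeGallLysikovZuiddam2025]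

Barriers (technique_class: rectangular-exponent, lattice-exchange, spectrum-shape): - technique_class: rectangular-exponent, lattice-exchange, spectrum-shape
- Literature.Barriers.MatrixMultiplication.RectangularBarrier: APPLIES to crux 2 and is priced: by
Thm 3.15 / eq. (5) with the upper support functionals (CLLZ2025_lem41/42, proved adequate in tree)
every CW_q T-method has ω̂(1,1,3) ≥ 4.0344 (computed, q = 2..14, increasing in q); evasion = a
carrier T with ρ_θ = log R̃(T)/log ζ^θ(T) ≤ 4/(4 − 2θ₁) for all θ, i.e. a support distribution with
uniform leg-2/3 marginals whose leg-1 entropy can be raised at no first-order cost — CW_q fails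
exactly this tangency (its uniform-marginal optimum has H(P₁) = 0); not in class for crux 3 (no
T-method is run).
- Literature.Barriers.MatrixMultiplication.InfimumNotMinimumBarrier: respected — both cruxes are
asymptotic (∀ε / admissible-exponent) statements; no single format certifies an exponent; the finite
shadow cells claim nothing about ω.
- Literature.Barriers.MatrixMultiplication.IrreversibilityBarrier: inherited by crux 2 only if E₃ is
attacked through a fixed irreversible carrier (then ω̂(1,1,3) is priced by the carrier's
irreversibility exactly as CLLZ do); crux 3 not in class.
- Literature.Barriers.MatrixMultiplication.UniversalMethodBarrier: not in class for crux 3; for crux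
2 a universal-method proof from CW_q is excluded by the sharper rectangular cap above; the entry's
ω_u(CW_q) ≥ 2.168 concerns the square format only.
- Literature.Barriers.MatrixMultiplication.UnstableTensorBarrier: not in class (no structu

History (route lifecycle, newest last):
- 2026-08-25T05:36:44Z · DORMANT — reconciler: no traction for 7.4 d (last activity item-evidence-added at 2026-08-17T19:02:28Z); parked, not closed — `ledger route dormant route-MatrixMultiplica (operator:999:2596227)

sub-problem: MatrixMultiplication · status: dormant · opened planner-plan-lens3-MatrixMultiplication-decomp-0 2026-08-17T02:18:20Z · rev 1 · ledger route-MatrixMultiplication-CubicExchangeSplit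
GENERATED by the gate from the ledger (D-0016/17). Provers cite these decls: `theorem foo : Summit.MatrixMultiplication.MatrixMultiplication.Theses.CubicExchangeSplit.<Decl> := …` in Summits/MatrixMultiplication/MatrixMultiplication/Theorems/<Name>.lean.
-/

namespace Summit.MatrixMultiplication.MatrixMultiplication.Theses.CubicExchangeSplit

open scoped BigOperators Topology Manifold Classical MeasureTheory ProbabilityTheory Matrix InnerProductSpace ComplexConjugate ContinuousMap
open Filter Set Function TopologicalSpace MeasureTheory

attribute [summit_statement] _root_.MatrixMultiplication

/-- item stmt-MatrixMultiplication-18000 · crux · rank 2 · open · by planner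
why it might fail: record ω(1,1,3) ≤ 4.198809 (VXXZ2024); every CW_q T-method is capped at ω̂(1,1,3) ≥ 4.0344 (q=2) … 4.1136 (q=14) by CLLZ Thm 3.15 (computed here), so a carrier outside {CW_q} with first-order-free leg-1 entropy is needed.
sources: VassilevskaWilliamsXuXuZhou2024, ChristandlLeGallLysikovZuiddam2025, Coppersmith1982, LottiRomani1983, LeGallUrrutia2018
[crux] E₃, perfect cubic amortisation: for every ε > 0, R(⟨n,n,n³⟩) = O(n^{4+ε}) (R = tensorRank ∘
matMulTensor ℂ), i.e. ω(1,1,3) = 4 = its flattening bound: applying an n × n matrix to n³ vectors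
costs n^{1+o(1)} per vector. The k = 3 rung below EPRFaces.RectExponentTwoEqThree (k = 2, which
implies it by blocking) and above the known k = ∞ (Coppersmith 1982). [difficulty: open-problem] -/
@[route_item "route-MatrixMultiplication-CubicExchangeSplit", crux]
def CubicAmortisation : Prop :=
  ∀ ε : ℝ, 0 < ε → (fun n : ℕ => (Literature.Computability.AlgebraicComplexity.tensorRank (Literature.Computability.AlgebraicComplexity.matMulTensor ℂ n n (n ^ 3)) : ℝ)) =O[Filter.atTop] fun n : ℕ => (n : ℝ) ^ ((4 : ℝ) + ε)

/-- item stmt-MatrixMultiplication-18001 · crux · rank 3 · open · by planner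
why it might fail: an ω-maximising spectral point deep in the interior (ω − 2 > 2e(3), e.g. ω > 2.3976 with ω(1,1,3) = 4.1988) violates it; no exchange theorem among exponents is in print and no lower-bound technology can refute it short of ω > 2.
sources: Strassen1988, LottiRomani1983, ChristandlLeGallLysikovZuiddam2025, AlmanLi2026, VassilevskaWilliamsXuXuZhou2024
[crux] SUBMOD₃, the cubic exchange: for all real β, β' with R(⟨n³,n,n⟩) = O(n^β) and R(⟨n,n³,n⟩) =
O(n^{β'}) and every ε > 0 there are γ, γ' with γ + γ' ≤ β + β' + ε, R(⟨n³,n³,n⟩) = O(n^γ) and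
R(⟨n,n,n⟩) = O(n^{γ'}) — ShapeSubmodularity.ShapeSubmodular at the one lattice pair (3,1,1)&(1,3,1)
(join (3,3,1), meet (1,1,1)), up to n¹ = n; equivalently ω(3,3,1) + ω ≤ 2ω(1,1,3), i.e. ω − 2 ≤
2e(3) + (6 − ω(3,3,1)). [difficulty: open-problem] -/
@[route_item "route-MatrixMultiplication-CubicExchangeSplit", crux]
def CubicExchange : Prop :=
  ∀ β β' : ℝ, (fun n : ℕ => (Literature.Computability.AlgebraicComplexity.tensorRank (Literature.Computability.AlgebraicComplexity.matMulTensor ℂ (n ^ 3) n n) : ℝ)) =O[Filter.atTop] (fun n : ℕ => (n : ℝ) ^ β) → (fun n : ℕ => (Literature.Computability.AlgebraicComplexity.tensorRank (Literature.Computability.AlgebraicComplexity.matMulTensor ℂ n (n ^ 3) n) : ℝ)) =O[Filter.atTop] (fun n : ℕ => (n : ℝ) ^ β') → ∀ ε : ℝ, 0 < ε → ∃ γ γ' : ℝ, γ + γ' ≤ β + β' + ε ∧ (fun n : ℕ => (Literature.Computability.AlgebraicComplexity.tensorRank (Literature.Computability.AlgebraicComplexity.matMulTensor ℂ (n ^ 3)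 (n ^ 3) n) : ℝ)) =O[Filter.atTop] (fun n : ℕ => (n : ℝ) ^ γ) ∧ (fun n : ℕ => (Literature.Computability.AlgebraicComplexity.tensorRank (Literature.Computability.AlgebraicComplexity.matMulTensor ℂ n n n) : ℝ)) =O[Filter.atTop] (fun n : ℕ => (n : ℝ) ^ γ')

/-- item stmt-MatrixMultiplication-18002 · support · rank 9 · open · by planner
sources: Blaser2013, LottiRomani1983
[support] necessity of E₃: ω(ℂ) = 2 → CubicAmortisation (block ⟨n,n,n³⟩ = ⟨1,1,n²⟩ ⊠ ⟨n,n,n⟩: R ≤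
n²·R⟨n,n,n⟩ = O(n^{4+ε}) by Blaser2013_rank_matMulTensor_mul_le and tensorRank_matMulTensor_le);
records that refuting E₃ refutes the summit. [difficulty: provable-now] -/
@[route_item "route-MatrixMultiplication-CubicExchangeSplit"]
def AmortisationOfOmegaTwo : Prop :=
  MatrixMultiplication → (∀ ε : ℝ, 0 < ε → (fun n : ℕ => (Literature.Computability.AlgebraicComplexity.tensorRank (Literature.Computability.AlgebraicComplexity.matMulTensor ℂ n n (n ^ 3)) : ℝ)) =O[Filter.atTop] fun n : ℕ => (n : ℝ) ^ ((4 : ℝ) + ε))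

/-- item stmt-MatrixMultiplication-18003 · support · rank 9 · open · by planner
sources: LottiRomani1983, Blaser2013
[support] necessity of SUBMOD₃: ω(ℂ) = 2 → CubicExchange (ω = 2 gives R⟨n³,n³,n⟩ = O(n^{6+ε}) via
⟨n²,n²,1⟩ ⊠ ⟨n,n,n⟩ and R⟨n,n,n⟩ = O(n^{2+ε}); flattening forces β, β' ≥ 4, so γ = 6 + ε/2, γ' = 2 +
ε/2 serve); records that refuting SUBMOD₃ refutes the summit. [difficulty: M] -/
@[route_item "route-MatrixMultiplication-CubicExchangeSplit"]
def ExchangeOfOmegaTwo : Prop :=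
  MatrixMultiplication → (∀ β β' : ℝ, (fun n : ℕ => (Literature.Computability.AlgebraicComplexity.tensorRank (Literature.Computability.AlgebraicComplexity.matMulTensor ℂ (n ^ 3) n n) : ℝ)) =O[Filter.atTop] (fun n : ℕ => (n : ℝ) ^ β) → (fun n : ℕ => (Literature.Computability.AlgebraicComplexity.tensorRank (Literature.Computability.AlgebraicComplexity.matMulTensor ℂ n (n ^ 3) n) : ℝ)) =O[Filter.atTop] (fun n : ℕ => (n : ℝ) ^ β') → ∀ ε : ℝ, 0 < ε → ∃ γ γ' : ℝ, γ + γ' ≤ β + β' + ε ∧ (fun n : ℕ => (Literature.Computability.AlgebraicComplexity.tensorRank (Literature.Computability.AlgebraicComplexity.matMulTensor ℂ (n ^ 3) (n ^ 3) n) : ℝ)) =O[Filter.atTop] (fun n : ℕ => (n : ℝ) ^ γ) ∧ (fun n : ℕ => (Literature.Computability.AlgebraicComplexity.tensorRank (Literature.Computability.AlgebraicComplexity.matMulTensor ℂ n n n) : ℝ)) =O[Filter.atTop] (fun n : ℕ => (n : ℝ) ^ γ'))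

/-- item stmt-MatrixMultiplication-18004 · support · rank 9 · open · by planner
sources: AlmanDuanVassilevskaWilliamsXuXuZhou2025, Blaser2013, LottiRomani1983
[support] what E₃ alone gives: CubicAmortisation → ω ≤ 12/5, by the single-summand asymptotic sum
inequality (n·n·n³)^{ω/3} ≤ R̃⟨n,n,n³⟩ ≤ R⟨n,n,n³⟩ (tree sum_rpow_omega_le_asymptoticRank, as in
EPRFaces.RungTwoConsequences); certifies that E₃ is not record-strength (12/5 > 2.371339).
[difficulty: M] -/
@[route_item "route-MatrixMultiplication-CubicExchangeSplit"]
def AmortisationConsequence : Prop :=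
  (∀ ε : ℝ, 0 < ε → (fun n : ℕ => (Literature.Computability.AlgebraicComplexity.tensorRank (Literature.Computability.AlgebraicComplexity.matMulTensor ℂ n n (n ^ 3)) : ℝ)) =O[Filter.atTop] fun n : ℕ => (n : ℝ) ^ ((4 : ℝ) + ε)) → Literature.Computability.AlgebraicComplexity.omega ℂ ≤ 12 / 5

/-- item stmt-MatrixMultiplication-18005 · support · rank 9 · open · by planner
sources: LottiRomani1983, VassilevskaWilliamsXuXuZhou2024
[support] what SUBMOD₃ alone gives (the two-beta bridge at k = 3, = the deciding theorem minus E₃):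
CubicExchange → every admissible β for ⟨n,n,n³⟩ bounds ω ≤ 2(β − 3); with the printed ω(1,1,3) ≤
4.198809 this is ω ≤ 2.397618, not a record. [difficulty: provable-now] -/
@[route_item "route-MatrixMultiplication-CubicExchangeSplit"]
def ExchangeConsequence : Prop :=
  (∀ β β' : ℝ, (fun n : ℕ => (Literature.Computability.AlgebraicComplexity.tensorRank (Literature.Computability.AlgebraicComplexity.matMulTensor ℂ (n ^ 3) n n) : ℝ)) =O[Filter.atTop] (fun n : ℕ => (n : ℝ) ^ β) → (fun n : ℕ => (Literature.Computability.AlgebraicComplexity.tensorRank (Literature.Computability.AlgebraicComplexity.matMulTensor ℂ n (n ^ 3) n) : ℝ)) =O[Filter.atTop] (fun n : ℕ => (n : ℝ) ^ β') → ∀ ε : ℝ, 0 < ε → ∃ γ γ' : ℝ, γ + γ' ≤ β + β' + ε ∧ (fun n : ℕ => (Literature.Computability.AlgebraicComplexity.tensorRank (Literature.Computability.AlgebraicComplexity.matMulTensor ℂ (n ^ 3) (n ^ 3) n) : ℝ)) =O[Filter.atTop] (fun n : ℕ => (n : ℝ) ^ γ) ∧ (fun n : ℕ => (Literature.Computability.AlgebraicComplexity.tensorRank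 (Literature.Computability.AlgebraicComplexity.matMulTensor ℂ n n n) : ℝ)) =O[Filter.atTop] (fun n : ℕ => (n : ℝ) ^ γ')) → ∀ β : ℝ, ((fun n : ℕ => (Literature.Computability.AlgebraicComplexity.tensorRank (Literature.Computability.AlgebraicComplexity.matMulTensor ℂ n n (n ^ 3)) : ℝ)) =O[Filter.atTop] fun n : ℕ => (n : ℝ) ^ β) → Literature.Computability.AlgebraicComplexity.omega ℂ ≤ 2 * (β - 3)

/-- item stmt-MatrixMultiplication-18006 · support · rank 9 · open · by planner
sources: Strassen1988, Coppersmith1982, LottiRomani1983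
[support] X_of_subs for the ceiling leaf X = FaceMaximiser (EPRFaces/LongBlockAmortisation, ≡ S):
CubicAmortisation → CubicExchange → B, with B's signature inlined verbatim (for every k ≥ 1 and
admissible β for ⟨n,n,n^k⟩, ω + (k − 1) ≤ β); proof = deciding theorem then EPRFaces.Converse
(proved, Theorems converse_proof). [difficulty: provable-now] -/
@[route_item "route-MatrixMultiplication-CubicExchangeSplit"]
def FaceMaximiserOfSubs : Prop :=
  (∀ ε : ℝ, 0 < ε → (fun n : ℕ => (Literature.Computability.AlgebraicComplexity.tensorRank (Literature.Computability.AlgebraicComplexity.matMulTensor ℂ n n (n ^ 3)) : ℝ)) =O[Filter.atTop] fun n : ℕ => (n : ℝ) ^ ((4 : ℝ) + ε)) → (∀ β β' : ℝ, (fun n : ℕ => (Literature.Computability.AlgebraicComplexity.tensorRank (Literature.Computability.AlgebraicComplexity.matMulTensor ℂ (n ^ 3) n n) : ℝ)) =O[Filter.atTop] (fun n : ℕ => (n : ℝ) ^ β) → (fun n : ℕ => (Literature.Computability.AlgebraicComplexity.tensorRank (Literature.Computability.AlgebraicComplexity.matMulTensor ℂ n (n ^ 3) n) : ℝ)) =O[Filter.atTop]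 (fun n : ℕ => (n : ℝ) ^ β') → ∀ ε : ℝ, 0 < ε → ∃ γ γ' : ℝ, γ + γ' ≤ β + β' + ε ∧ (fun n : ℕ => (Literature.Computability.AlgebraicComplexity.tensorRank (Literature.Computability.AlgebraicComplexity.matMulTensor ℂ (n ^ 3) (n ^ 3) n) : ℝ)) =O[Filter.atTop] (fun n : ℕ => (n : ℝ) ^ γ) ∧ (fun n : ℕ => (Literature.Computability.AlgebraicComplexity.tensorRank (Literature.Computability.AlgebraicComplexity.matMulTensor ℂ n n n) : ℝ)) =O[Filter.atTop] (fun n : ℕ => (n : ℝ) ^ γ')) → ∀ k : ℕ, 1 ≤ k → ∀ β : ℝ, ((fun n : ℕ => (Literature.Computability.AlgebraicComplexity.tensorRank (Literature.Computability.AlgebraicComplexity.matMulTensor ℂ n n (n ^ k)) : ℝ)) =O[Filter.atTop] fun n : ℕ => (n : ℝ) ^ β) → Literature.Computability.AlgebraicComplexity.omega ℂ + ((k : ℝ) - 1) ≤ β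

/-- item stmt-MatrixMultiplication-18007 · support · rank 9 · closed · proved by Summit.MatrixMultiplication.MatrixMultiplication.Theorems.ShapeSubmodularOfSubs.shapeSubmodularOfSubs_proof @ 026f4191ea7a (operator) · by planner
sources: LottiRomani1983, Blaser2013, Strassen1988
[support] X_of_subs for the ceiling leaf X = ShapeSubmodular (tier-B parent, ≡ S): CubicAmortisation
→ CubicExchange → SUBMOD on the whole integer format lattice, ShapeSubmodular's signature inlined
verbatim; proof = deciding theorem then ShapeSubmodularity.SubmodOfOmegaTwo (open support of the
parent, difficulty M). [difficulty: M] -/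
@[route_item "route-MatrixMultiplication-CubicExchangeSplit"]
def ShapeSubmodularOfSubs : Prop :=
  (∀ ε : ℝ, 0 < ε → (fun n : ℕ => (Literature.Computability.AlgebraicComplexity.tensorRank (Literature.Computability.AlgebraicComplexity.matMulTensor ℂ n n (n ^ 3)) : ℝ)) =O[Filter.atTop] fun n : ℕ => (n : ℝ) ^ ((4 : ℝ) + ε)) → (∀ β β' : ℝ, (fun n : ℕ => (Literature.Computability.AlgebraicComplexity.tensorRank (Literature.Computability.AlgebraicComplexity.matMulTensor ℂ (n ^ 3) n n) : ℝ)) =O[Filter.atTop] (fun n : ℕ => (n : ℝ) ^ β) → (fun n : ℕ => (Literature.Computability.AlgebraicComplexity.tensorRank (Literature.Computability.AlgebraicComplexity.matMulTensor ℂ n (n ^ 3) n) : ℝ)) =O[Filter.atTop] (fun n : ℕ => (n : ℝ) ^ β') → ∀ ε : ℝ, 0 < ε → ∃ γ γ' : ℝ, γ + γ' ≤ β + β' + ε ∧ (fun n : ℕ => (Literature.Computability.AlgebraicComplexity.tensorRank (Literature.Computability.AlgebraicComplexity.matMulTensor ℂ (n ^ 3) (n ^ 3) n) : ℝ)) =O[Filter.atTop]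 (fun n : ℕ => (n : ℝ) ^ γ) ∧ (fun n : ℕ => (Literature.Computability.AlgebraicComplexity.tensorRank (Literature.Computability.AlgebraicComplexity.matMulTensor ℂ n n n) : ℝ)) =O[Filter.atTop] (fun n : ℕ => (n : ℝ) ^ γ')) → ∀ a b c a' b' c' : ℕ, ∀ β β' : ℝ, (fun n : ℕ => (Literature.Computability.AlgebraicComplexity.tensorRank (Literature.Computability.AlgebraicComplexity.matMulTensor ℂ (n ^ a) (n ^ b) (n ^ c)) : ℝ)) =O[Filter.atTop] (fun n : ℕ => (n : ℝ) ^ β) → (fun n : ℕ => (Literature.Computability.AlgebraicComplexity.tensorRank (Literature.Computability.AlgebraicComplexity.matMulTensor ℂ (n ^ a') (n ^ b') (n ^ c')) : ℝ)) =O[Filter.atTop] (fun n : ℕ => (n : ℝ) ^ β') → ∀ ε : ℝ, 0 < ε → ∃ γ γ' : ℝ, γ + γ' ≤ β + β' + ε ∧ (fun n : ℕ => (Literature.Computability.AlgebraicComplexity.tensorRank (Literature.Computability.AlgebraicComplexity.matMulTensor ℂ (n ^ max a a') (n ^ max b b') (n ^ max c c')) : ℝ)) =O[Filter.atTop] (fun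 n : ℕ => (n : ℝ) ^ γ) ∧ (fun n : ℕ => (Literature.Computability.AlgebraicComplexity.tensorRank (Literature.Computability.AlgebraicComplexity.matMulTensor ℂ (n ^ min a a') (n ^ min b b') (n ^ min c c')) : ℝ)) =O[Filter.atTop] (fun n : ℕ => (n : ℝ) ^ γ')

/-- item stmt-MatrixMultiplication-18008 · assembly · rank 1 · open · by planner
sources: LottiRomani1983, Blaser2013, Coppersmith1982
[assembly] CubicAmortisation → CubicExchange → ω(ℂ) = 2. -/
@[route_item "route-MatrixMultiplication-CubicExchangeSplit"]
def Assembly : Prop :=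
  CubicAmortisation → CubicExchange → MatrixMultiplication

/-! D-0027 §2.1 — DECIDING THEOREM (planner-authored via `route open/edit --closes-file`; by planner-plan-lens3-MatrixMultiplication-decomp-0 2026-08-17T02:18:20Z):
its hypotheses are this route's items and its conclusion the sub-problem Statement (glue_lint), and it elaborates with this file. -/

@[closes "route-MatrixMultiplication-CubicExchangeSplit"] theorem closes (hA : CubicAmortisation) (hX : CubicExchange) : _root_.MatrixMultiplication := by
  -- (1) flattening in exponent coordinates: an O(n^γ) bound on R⟨n³, n³, n⟩ forces 6 ≤ γ
  have flat : ∀ γ : ℝ,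
      (fun n : ℕ => (Literature.Computability.AlgebraicComplexity.tensorRank
        (Literature.Computability.AlgebraicComplexity.matMulTensor ℂ (n ^ 3) (n ^ 3) n) : ℝ))
        =O[Filter.atTop] (fun n : ℕ => (n : ℝ) ^ γ) → (6 : ℝ) ≤ γ := by
    intro γ hγ
    by_contra hlt
    rw [not_le] at hlt
    obtain ⟨C, hC⟩ := Asymptotics.isBigO_iff.1 hγ
    have hev : ∀ᶠ n : ℕ in Filter.atTop, (n : ℝ) ^ ((6 : ℝ) - γ) ≤ C := by
      filter_upwards [hC, Filter.eventually_gt_atTop 0] with n hn hn0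
      have hn0' : (0 : ℝ) < n := Nat.cast_pos.2 hn0
      rw [Real.norm_of_nonneg (Nat.cast_nonneg _),
        Real.norm_of_nonneg (Real.rpow_nonneg (Nat.cast_nonneg _) _)] at hn
      have hflat : n ^ 3 * n ^ 3 ≤ Literature.Computability.AlgebraicComplexity.tensorRank
          (Literature.Computability.AlgebraicComplexity.matMulTensor ℂ (n ^ 3) (n ^ 3) n) := by
        haveI : NeZero n := ⟨hn0.ne'⟩
        exact Literature.Computability.AlgebraicComplexity.mul_le_tensorRank_matMulTensor_left ℂ
          (n ^ 3) (n ^ 3) n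
      have hpow : (n : ℝ) ^ (6 : ℝ) = ((n ^ 3 * n ^ 3 : ℕ) : ℝ) := by
        rw [show (6 : ℝ) = ((6 : ℕ) : ℝ) by norm_num, Real.rpow_natCast]
        push_cast
        ring
      have hsq : (n : ℝ) ^ (6 : ℝ) ≤ C * (n : ℝ) ^ γ := by
        refine le_trans ?_ hn
        rw [hpow]
        exact_mod_cast hflat
      rw [Real.rpow_sub hn0', div_le_iff₀ (Real.rpow_pos_of_pos hn0' _)]
      exact hsq
    have hlim : Filter.Tendsto (fun n : ℕ => (n : ℝ) ^ ((6 : ℝ) - γ)) Filter.atTop Filter.atTop :=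
      (tendsto_rpow_atTop (by linarith)).comp tendsto_natCast_atTop_atTop
    obtain ⟨n, hn₁, hn₂⟩ := (hev.and (hlim.eventually_gt_atTop C)).exists
    exact absurd hn₁ (not_le.2 hn₂)
  -- (2) ω ≤ 2: cubic amortisation at slack ε/8, rotated into the formats (3,1,1) and (1,3,1),
  --     then the cubic exchange at slack ε/4, flattening on the join and csInf on the meet
  have hle : Literature.Computability.AlgebraicComplexity.omega ℂ ≤ 2 := by
    refine le_of_forall_pos_lt_add fun ε hε => ?_
    have hO := hA (ε / 8) (by positivity)
    have h311 : (fun n : ℕ => (Literature.Computability.AlgebraicComplexity.tensorRank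
        (Literature.Computability.AlgebraicComplexity.matMulTensor ℂ (n ^ 3) n n) : ℝ))
        =O[Filter.atTop] (fun n : ℕ => (n : ℝ) ^ ((4 : ℝ) + ε / 8)) := by
      have hfun : (fun n : ℕ => (Literature.Computability.AlgebraicComplexity.tensorRank
          (Literature.Computability.AlgebraicComplexity.matMulTensor ℂ (n ^ 3) n n) : ℝ)) =
          fun n : ℕ => (Literature.Computability.AlgebraicComplexity.tensorRank
            (Literature.Computability.AlgebraicComplexity.matMulTensor ℂ n n (n ^ 3)) : ℝ) := by
        funext n
        rw [Literature.Computability.AlgebraicComplexity.tensorRank_matMulTensor_rotate ℂ (n ^ 3) n n]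
      rw [hfun]
      exact hO
    have h131 : (fun n : ℕ => (Literature.Computability.AlgebraicComplexity.tensorRank
        (Literature.Computability.AlgebraicComplexity.matMulTensor ℂ n (n ^ 3) n) : ℝ))
        =O[Filter.atTop] (fun n : ℕ => (n : ℝ) ^ ((4 : ℝ) + ε / 8)) := by
      have hfun : (fun n : ℕ => (Literature.Computability.AlgebraicComplexity.tensorRank
          (Literature.Computability.AlgebraicComplexity.matMulTensor ℂ n (n ^ 3) n) : ℝ)) =
          fun n : ℕ => (Literature.Computability.AlgebraicComplexity.tensorRank
            (Literature.Computability.AlgebraicComplexity.matMulTensor ℂ n n (n ^ 3)) : ℝ) := by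
        funext n
        rw [Literature.Computability.AlgebraicComplexity.tensorRank_matMulTensor_rotate ℂ n (n ^ 3) n,
          Literature.Computability.AlgebraicComplexity.tensorRank_matMulTensor_rotate ℂ (n ^ 3) n n]
      rw [hfun]
      exact hO
    obtain ⟨γ, γ', hsum, hjoin, hmeet⟩ :=
      hX ((4 : ℝ) + ε / 8) ((4 : ℝ) + ε / 8) h311 h131 (ε / 4) (by positivity)
    -- flattening on the join ⟨n³,n³,n⟩: 6 ≤ γ
    have hγ : (6 : ℝ) ≤ γ := flat γ hjoin
    -- the meet is ⟨n,n,n⟩: γ' is an admissible exponent, so ω ≤ γ'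
    have hγ' : Literature.Computability.AlgebraicComplexity.omega ℂ ≤ γ' :=
      csInf_le (Literature.Computability.AlgebraicComplexity.admissibleExponents_bddBelow ℂ) hmeet
    linarith
  exact (_root_.MatrixMultiplication_iff).2
    (le_antisymm hle (Literature.Computability.AlgebraicComplexity.omega_two_le ℂ))

end Summit.MatrixMultiplication.MatrixMultiplication.Theses.CubicExchangeSplit
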